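import Summits.BirchSwinnertonDyer.BirchSwinnertonDyer.Theorems.SignedLowerHalvesSmallImageLowerHalfBothSignsRttKanVatsalSymbols
import Summits.BirchSwinnertonDyer.BirchSwinnertonDyer.Theorems.SignedLowerHalvesSmallImageLowerHalfBothSignsRttKanUnitContent
import Summits.BirchSwinnertonDyer.BirchSwinnertonDyer.Theorems.ResidualThetaTransportAtTwoThetaLayerLambdaCongruenceAtTwoLayerLambdaStable
import Summits.BirchSwinnertonDyer.BirchSwinnertonDyer.Theorems.ResidualThetaTransportAtTwoThetaLayerLambdaCongruenceAtTwoSupNormIsometry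
import HarnessLib

/-!
# Route `SignedLowerHalves`, crux L `SmallImageLowerHalfBothSigns` (item stmt-BirchSwinnertonDyer-23599), line `rtt_w3` (v3) —
# stub Kan₂ `stub_thetaLayerLambda_ns`: EQUAL LAYER-`λ` of the curve's and the partner's `S₀`-depleted Mazur–Tate polynomials

Width seat `bsd-line-slh-p3-w3` g11 under LEAD `cruxlead-stmt-BirchSwinnertonDyer-23599` g0 (cell `bsd-ssimc`); STUB BRIEF
`BRIEF-Kan2.md`. Lands the REGISTERED v3 stub `stub_thetaLayerLambda_ns` (skeleton of record `Lines/rtt_w3.lean`, sha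
efa36f4c8be01e57; text token-identical, first hypothesis the printed input `vatsal1999_plusSymbol_congruence` BY NAME — so the
theorem is exactly as conditional as the line designed it) `--supports stmt-BirchSwinnertonDyer-23599`. THEOREMS ONLY — no
definition, no `sorry`; closes nothing by itself; BSD is not proved by any of this.

THE ARGUMENT (Vatsal 1999 §1 + Greenberg–Vatsal 2000 §3, at the EXACT common level). By bricks K1/K1′
(`depletedCurveLayer_eq_layerSum_depletedSymbol'`, `depletedPartnerLayer_eq_layerSum_depletedSymbol'`) the two polynomials of
the stub are the layer sums `ϑ_n(φ) = Σ_{t mod pⁿ} (Σ_{η∈μ_{p−1}} φ(x_{η,t})) (1+X)^t` of the `S₀`-depleted plus symbols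
`φ^{S₀}_W` and `φ^{S₀}_{g,Ω}`; by brick K5 (`eventually_supNorm_depleted_eq_one_of_isPollackPair`, Pollack 2003 + unit content)
`‖ϑ_n(φ^{S₀}_W)‖_sup = 1` at every large layer of the parity of `ε`; by brick K9b (`exists_unit_symbol_congruence` — Vatsal's
Thm. (1.6)/(1.13) for the depleted pair `(f′, g′)` on the common `Γ₀(L)`) there are `u_f, u_g` with `u_g ≠ 0`, `‖u_f‖ ≥ 1`,
`‖u_f φ^{S₀}_W‖ ≤ 1` and `‖u_f φ^{S₀}_W − u_g φ^{S₀}_{g,Ω}‖ < 1` pointwise. Hence (§1, ultrametric bookkeeping + the `(1+X)^t`-basis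
isometry of cell `ResidualThetaTransportAtTwo`) `‖u_f‖ = 1`, `‖ϑ_n(φ^{S₀}_W) − (u_g/u_f) ϑ_n(φ^{S₀}_{g,Ω})‖_sup < 1 = ‖ϑ_n(φ^{S₀}_W)‖_sup`,
and `λ` is stable under such perturbations (`layerLambda_eq_of_supNorm_sub_C_mul_lt`, Pollack–Weston §3.1): the two layer-`λ`'s
are equal.

* §1 `norm_mul_finsum_le_one`, `norm_mul_finsum_sub_lt_one`, ★ `layerLambda_layerSum_eq_of_unit_congruence` (pure ultrametric
  algebra over any ultrametric normed field).
* §2 ★ `stub_thetaLayerLambda_ns` (the registered text).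

References: [Vatsal1999] Thm. (1.6), (1.10)–(1.11), (1.13); [GreenbergVatsal2000] §1 (8)–(9), §3 (18)–(19); [Pollack2003] Prop. 6.18;
[PollackWeston2011MT] §2.2–§3.1, Thm. 4.1; [Kobayashi2003] Thm. 1.2.
-/

set_option autoImplicit false
-- D-0017: single-problem summit, the namespace repeats the problem name by design.
set_option linter.dupNamespace false

noncomputable section

open scoped Classical MatrixGroups ModularForm BigOperators

open CongruenceSubgroup WeierstrassCurve Polynomial NumberField IsDedekindDomain
  Literature.NumberTheory.EllipticCurves Literature.NumberTheory.EllipticCurves.ModularForms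
  Literature.NumberTheory.EllipticCurves.Rank1Residual
  Literature.NumberTheory.EllipticCurves.GreenbergVatsal2000
  Literature.NumberTheory.IwasawaTheory Rat.HeightOneSpectrum
  Summit.BirchSwinnertonDyer.Rank1Residual.Supersingular
  Summit.BirchSwinnertonDyer.Rank1Residual.X1.MuLambda
  Summit.BirchSwinnertonDyer.Rank1Residual.X2.EulerFactorInvariants

namespace Summit.BirchSwinnertonDyer.BirchSwinnertonDyer.Theorems.SmallImageRttKan

open Summit.BirchSwinnertonDyer.BirchSwinnertonDyer.Theorems.ThetaLayerLambdaCongruenceAtTwo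
  (layerLambda_eq_of_supNorm_sub_C_mul_lt supNorm_C_mul exists_supNorm_sum_C_mul_X_add_one_pow_eq)

/-! ### §1 Ultrametric bookkeeping: unit ratio + symbol congruence ⟹ equal layer-`λ` -/

section Ultrametric

variable {K : Type*} [NormedField K] [IsUltrametricDist K]

/-- `‖u · Σ_i F_i‖ ≤ 1` if every `‖u F_i‖ ≤ 1` (finite index type; ultrametric inequality). [folklore] -/
theorem norm_mul_finsum_le_one {α : Type*} [Finite α] (F : α → K) (u : K) (h : ∀ i, ‖u * F i‖ ≤ 1) :
    ‖u * ∑ᶠ i, F i‖ ≤ 1 := by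
  haveI := Fintype.ofFinite α
  rw [finsum_eq_sum_of_fintype, Finset.mul_sum]
  exact IsUltrametricDist.norm_sum_le_of_forall_le_of_nonneg zero_le_one fun i _ ↦ h i

/-- `‖u · Σ_i F_i − w · Σ_i G_i‖ < 1` if every `‖u F_i − w G_i‖ < 1` (finite index type; STRICT ultrametric inequality: the norm
of a finite sum is attained by a summand). [folklore] -/
theorem norm_mul_finsum_sub_lt_one {α : Type*} [Finite α] (F G : α → K) (u w : K) (h : ∀ i, ‖u * F i - w * G i‖ < 1) :
    ‖u * ∑ᶠ i, F i - w * ∑ᶠ i, G i‖ < 1 := by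
  haveI := Fintype.ofFinite α
  rw [finsum_eq_sum_of_fintype, finsum_eq_sum_of_fintype, Finset.mul_sum, Finset.mul_sum, ← Finset.sum_sub_distrib]
  rcases (Finset.univ : Finset α).eq_empty_or_nonempty with he | hne
  · rw [he, Finset.sum_empty, norm_zero]; exact one_pos
  · obtain ⟨i, -, hi⟩ := IsUltrametricDist.exists_norm_finsetSum_le_of_nonempty hne (fun i ↦ u * F i - w * G i)
    exact hi.trans_lt (h i)

/-- ★ **Unit ratio + congruence ⟹ equal layer-`λ`.** Let `a, b : ℤ/m → K` and `u_f, u_g ∈ K` with `u_g ≠ 0`, `‖u_f‖ ≥ 1`,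
`‖u_f a_t‖ ≤ 1` and `‖u_f a_t − u_g b_t‖ < 1` for all `t`, and suppose the layer polynomial `θ = Σ_t a_t (1+X)^t` has
`‖θ‖_sup = 1`. Then `λ(θ) = λ(θ')` for `θ' = Σ_t b_t (1+X)^t`: indeed `‖u_f‖ = 1` (the sup norm is some `‖a_s‖`, so
`‖u_f‖ = ‖u_f a_s‖ ≤ 1`), `θ − (u_g/u_f)θ' = u_f⁻¹ Σ_t (u_f a_t − u_g b_t)(1+X)^t` has sup norm `< 1 = ‖θ‖_sup` (isometry of the
`(1+X)^t`-basis), and `λ` only sees the leading `p`-adic order (Pollack–Weston §3.1). [cite: PollackWeston2011MT, §3.1]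
[cite: Vatsal1999, (1.10)–(1.11)] -/
theorem layerLambda_layerSum_eq_of_unit_congruence {m : ℕ} [NeZero m] (a b : ZMod m → K) {uf ug : K} (hug : ug ≠ 0)
    (huf : 1 ≤ ‖uf‖) (ha : ∀ t, ‖uf * a t‖ ≤ 1) (hab : ∀ t, ‖uf * a t - ug * b t‖ < 1)
    (hsup : (∑ t : ZMod m, C (a t) * (X + 1) ^ t.val).supNorm = 1) :
    layerLambda (∑ t : ZMod m, C (a t) * (X + 1) ^ t.val) = layerLambda (∑ t : ZMod m, C (b t) * (X + 1) ^ t.val) := by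
  -- `‖u_f‖ = 1`
  obtain ⟨s, hs⟩ := exists_supNorm_sum_C_mul_X_add_one_pow_eq a
  have has : ‖a s‖ = 1 := hs.symm.trans hsup
  have hnuf : ‖uf‖ = 1 := by
    refine le_antisymm ?_ huf
    have h := ha s
    rwa [norm_mul, has, mul_one] at h
  have huf0 : uf ≠ 0 := norm_pos_iff.mp (by rw [hnuf]; exact one_pos)
  -- the difference polynomial
  have hD : (∑ t : ZMod m, C (a t) * (X + 1) ^ t.val) - C (ug / uf) * ∑ t : ZMod m, C (b t) * (X + 1) ^ t.val =
      C uf⁻¹ * ∑ t : ZMod m, C (uf * a t - ug * b t) * (X + 1) ^ t.val := by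
    rw [Finset.mul_sum, Finset.mul_sum, ← Finset.sum_sub_distrib]
    refine Finset.sum_congr rfl fun t _ ↦ ?_
    rw [← mul_assoc, ← mul_assoc, ← C_mul, ← C_mul, ← sub_mul, ← C_sub]
    congr 2
    field_simp
  obtain ⟨s', hs'⟩ := exists_supNorm_sum_C_mul_X_add_one_pow_eq (fun t ↦ uf * a t - ug * b t)
  refine layerLambda_eq_of_supNorm_sub_C_mul_lt (c := ug / uf) (div_ne_zero hug huf0) ?_
  rw [hD, supNorm_C_mul, norm_inv, hnuf, inv_one, one_mul, hs', hsup]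
  exact hab s'

end Ultrametric

/-! ### §2 The stub -/

section Stub

/-- ★ **Stub Kan₂ `stub_thetaLayerLambda_ns` of line `rtt_w3` (v3, registered text; first hypothesis = the printed input Vatsal 1999
Thm. (1.6)/(1.13) BY NAME).** On the class (`p` odd, `ClassX7 W p`, `a_p(W) = 0`), for the CM partner datum `(g, Ω, ι)` of level
`M` with `p ∤ M`, `max(2, v_ℓ M) = max(2, v_ℓ N_W)` (`ℓ ≠ p`), `a_p(g) = 0`, `ι a_ℓ(g) ≡ a_ℓ(W)` at the primes `ℓ ∤ pMN_W`, the
newform `f` of `W` with a Pollack pair `(L⁺, L⁻)` whose sign-`ε` member has unit content, and places `S₀ ∌ p` containing the bad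
places of `W` and the places of `M`: for all large layers `n` of the parity of `ε`, the `S₀`-DEPLETED layer polynomials of `W`
and of `(g, Ω)` have the SAME layer-`λ`. Proof: bricks K1′ (both sides are layer sums of the depleted symbols), K5 (`‖·‖_sup = 1` on
the `W`-side), K9b (Vatsal's unit-ratio symbol congruence for the depleted pair on the common exact level) and §1.
[cite: Vatsal1999, Thm. (1.6), (1.13), (1.10)–(1.11)] [cite: GreenbergVatsal2000, §1 (8)–(9), §3 (18)–(19)] [cite: Pollack2003, Prop. 6.18]
[cite: PollackWeston2011MT, §2.2, §3.1 and Thm. 4.1] -/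
theorem stub_thetaLayerLambda_ns : vatsal1999_plusSymbol_congruence →
    ∀ (W : WeierstrassCurve ℚ) [W.IsElliptic] [W.IsGloballyMinimal] (p : ℕ) [Fact p.Prime],
      p ≠ 2 → ClassX7 W p → ¬ W.HasCM → W.frobeniusTrace p = 0 → ¬ Surj W p →
      ∀ (ε : ℤˣ), ∀ (M : ℕ) [NeZero M] (g : CuspForm (Gamma0 M) 2) (ι : coeffField g →+* PadicAlgCl p) (Ω : ℂ),
        ¬ p ∣ M → (∀ ℓ : ℕ, ℓ.Prime → ℓ ≠ p → max 2 (padicValNat ℓ M) = max 2 (padicValNat ℓ (W.conductorNorm ℤ))) →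
        IsNewform0 g → Literature.NumberTheory.Automorphic.IsCMForm (liftToGamma1 M 2 g) →
        cuspCoeff g p = 0 → IsPlusPeriod g Ω →
        (∀ ℓ : ℕ, ℓ.Prime → ¬ ℓ ∣ p * M * W.conductorNorm ℤ →
          ‖embCoeff g ι ℓ - (W.frobeniusTrace ℓ : PadicAlgCl p)‖ < 1) →
        ∀ [NeZero (W.conductorNorm ℤ)] (f : CuspForm (Gamma0 (W.conductorNorm ℤ)) 2), IsNewformOf W f →
        ∀ (Lplus Lminus : IwasawaAlgebra p), IsPollackPair f p Lplus Lminus →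
          HasUnitContent (kobayashiL ε Lplus Lminus) →
        ∀ (S₀ : Finset (HeightOneSpectrum (𝓞 ℚ))), (∀ v ∈ S₀, ((p : ℕ) : 𝓞 ℚ) ∉ v.asIdeal) →
          (∀ v : HeightOneSpectrum (𝓞 ℚ), ¬ W.HasGoodReductionAt v → v ∈ S₀) →
          (∀ v : HeightOneSpectrum (𝓞 ℚ), natGenerator v ∣ M → v ∈ S₀) →
        ∃ n₀ : ℕ, ∀ n ≥ n₀, (Even n ↔ ε = 1) →
          layerLambda (((mazurTateElement f p n).map (algebraMap ℚ (PadicAlgCl p)) *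
              ∏ v ∈ S₀, ((W.localPolynomialAt v).map (Int.castRingHom (PadicAlgCl p))).comp
                (C ((natGenerator v : PadicAlgCl p)⁻¹) *
                  (X + 1) ^ (PadicInt.toZModPow n (-(frobeniusExponent p (natGenerator v : ℤ_[p])))).val)) %ₘ
              ((X + 1) ^ p ^ n - 1)) =
          layerLambda (((mazurTateElementK g Ω p n).map ι *
              ∏ v ∈ S₀, (1 - C (embCoeff g ι (natGenerator v)) * X +
                  (if natGenerator v ∣ M then 0 else C (natGenerator v : PadicAlgCl p)) * X ^ 2).comp
                (C ((natGenerator v : PadicAlgCl p)⁻¹) *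
                  (X + 1) ^ (PadicInt.toZModPow n (-(frobeniusExponent p (natGenerator v : ℤ_[p])))).val)) %ₘ
              ((X + 1) ^ p ^ n - 1)) := by
  intro hV W _ _ p _ hp2 hX7 _hCM hap _hsurj ε M _ g ι Ω hpM hlev hg _hgCM hgp hΩ hcong _ f hf Lplus Lminus hPP hunit S₀
    hS₀p hS₀bad hS₀M
  classical
  have hp : p.Prime := Fact.out
  have hS : ∀ v ∈ S₀, natGenerator v ≠ p := fun v hv ↦ natGenerator_ne_of_natCast_not_mem v (hS₀p v hv)
  -- Vatsal's unit-ratio symbol congruence for the depleted pair (brick K9b)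
  obtain ⟨uf, ug, hug, huf, hA, hAB⟩ :=
    exists_unit_symbol_congruence hV W hp2 hX7 hap ι hpM hlev hg hgp hΩ hcong hf S₀ hS hS₀bad hS₀M
  -- `‖R_W‖_sup = 1` eventually at the parity of `ε` (brick K5)
  obtain ⟨n₀, hn₀⟩ := eventually_supNorm_depleted_eq_one_of_isPollackPair W hp2 f hPP ε hunit S₀ hS
  refine ⟨n₀, fun n hn hpar ↦ ?_⟩
  have hsup := (hn₀ n hn hpar).1
  haveI : NeZero (p ^ n) := ⟨pow_ne_zero _ hp.ne_zero⟩
  haveI := neZero_torsionOrder p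
  -- both sides are layer sums of the depleted symbols (brick K1′)
  rw [depletedCurveLayer_eq_layerSum_depletedSymbol' f W n S₀ hS] at hsup ⊢
  rw [depletedPartnerLayer_eq_layerSum_depletedSymbol' g Ω ι n M S₀ hS]
  exact layerLambda_layerSum_eq_of_unit_congruence _ _ hug huf
    (fun t ↦ norm_mul_finsum_le_one _ _ fun η ↦ hA _)
    (fun t ↦ norm_mul_finsum_sub_lt_one _ _ _ _ fun η ↦ hAB _) hsup

end Stub

end Summit.BirchSwinnertonDyer.BirchSwinnertonDyer.Theorems.SmallImageRttKan

end
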